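import Summits.HubbardSuperconductivity.HubbardSuperconductivity.Theorems.PbContinuationEndpointClosure
import Literature.MathematicalPhysics.QuantumLattice.PairFieldYangCeiling

/-!
# Crux `PbContinuation` (stmt-HubbardSuperconductivity-0907) — the every-ground-state upgrade at the
# endpoint `t' = 1` under UNIQUENESS of the pure-torus sector ground state (positive-side support)

Sequel of `Theorems/PbContinuationEndpointClosure.lean`. There, an every-GS `d_{x²-y²}` order bound
for the checkerboard tori `H_L(t',U)` on a left neighbourhood `[t₁,1)` of the uniform point was shown
to survive for SOME normalised sector ground state of the pure torus `hubbardTorus 2 L 1 U`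
(`exists_groundState_order_at_one`, `endpointClosure`). Here:

* `forall_groundState_order_at_one_of_unique` — if the `(2n, S^z = 0)`-sector ground state of
  `hubbardTorus 2 L 1 U` is unique up to a scalar (the strategist census's `UniqueAtOne` at that
  side), the bound holds for EVERY normalised sector ground state (two unit vectors on one ray have
  the same expectations);
* `everyGSOrderFour_of_walk_of_unique` — eventual form on the crux's terms: the census's
  decomposition D4 (`UniformWalkIco ∧ UniqueAtOne → EveryGSOrderFour`, `Cruxes/PbContinuation/
  STRATEGY_CENSUS.lean`) minus its mod-4 residue `stub_evenSides`, all predicates written out,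
  under the guard `-1 ≤ δ`.

Both remaining hypotheses are open (and the uniform walk is at least as strong as the crux at
`(U,δ)`); this is bookkeeping that any continuation line ending in a unique ground state would use,
not progress on the crux's truth. Folklore finite-dimensional analysis (Kato (1966) II §5.1;
Tasaki (2020) §2.1). No definition is introduced.
-/

noncomputable section

namespace Summit.HubbardSuperconductivity.PbContinuation

open Matrix
open Literature.MathematicalPhysics.QuantumLattice Literature.Probability.LatticeModels

/-! ### The every-GS upgrade at the endpoint under uniqueness -/

/-- Two normalised vectors on one ray have the same expectations. [folklore] -/
theorem re_expect_eq_of_smul {ι : Type*} [Fintype ι] (A : Matrix (Finset ι) (Finset ι) ℂ)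
    {ψ φ : Fock ι} (hψ : star ψ ⬝ᵥ ψ = 1) (hφ : star φ ⬝ᵥ φ = 1) {a : ℂ} (ha : φ = a • ψ) :
    (expect A φ).re = (expect A ψ).re := by
  have haa : star a * a = 1 := by
    have h1 : star φ ⬝ᵥ φ = star a * a * (star ψ ⬝ᵥ ψ) := by
      rw [ha, star_smul, smul_dotProduct, dotProduct_smul, smul_smul, smul_eq_mul]
    rw [hφ, hψ, mul_one] at h1
    exact h1.symm
  rw [ha, PairFieldYang.expect_smul_vec_eq, haa, one_mul]

/-- **Every-GS endpoint bound under uniqueness.** If, in addition to the hypothesis of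
`exists_groundState_order_at_one`, the `(2n, 0)`-sector ground state of the pure torus is unique up
to a scalar (the census's `UniqueAtOne` at this side), then EVERY normalised sector ground state of
`hubbardTorus 2 L 1 U` has `B ≤ re⟨ψ, Δ_dᴴΔ_d ψ⟩`. Kato (1966) II §5.1. [folklore] -/
theorem forall_groundState_order_at_one_of_unique :
    ∀ (U : ℝ) (L : ℕ) [NeZero L] (n : ℕ), n ≤ L ^ 2 → ∀ (B t₁ : ℝ), t₁ < 1 →
      (∀ t' ∈ Set.Ico t₁ 1, ∀ ψ : Fock (Orb (FermionTorus 2 L)), star ψ ⬝ᵥ ψ = 1 →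
        IsGroundStateInSector
          (hamiltonian ((fermionTorusGraph 2 L) \ SimpleGraph.comap
              (fun x : FermionTorus 2 L => fun i : Fin 2 => ((ofLex x) i : ℕ) / 2) ⊤) 1 U +
            hamiltonian ((fermionTorusGraph 2 L) ⊓ SimpleGraph.comap
              (fun x : FermionTorus 2 L => fun i : Fin 2 => ((ofLex x) i : ℕ) / 2) ⊤) t' 0) (2 * n) 0 ψ →
          B ≤ (expect ((pairField dWaveFormFactor L)ᴴ * pairField dWaveFormFactor L) ψ).re) →
      (∀ ψ φ : Fock (Orb (FermionTorus 2 L)),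
        IsGroundStateInSector (hubbardTorus 2 L 1 U) (2 * n) 0 ψ →
        IsGroundStateInSector (hubbardTorus 2 L 1 U) (2 * n) 0 φ → ∃ a : ℂ, φ = a • ψ) →
      ∀ ψ : Fock (Orb (FermionTorus 2 L)), star ψ ⬝ᵥ ψ = 1 →
        IsGroundStateInSector (hubbardTorus 2 L 1 U) (2 * n) 0 ψ →
          B ≤ (expect ((pairField dWaveFormFactor L)ᴴ * pairField dWaveFormFactor L) ψ).re := by
  intro U L _ n hn B t₁ ht₁ h huniq ψ hψu hψgs
  obtain ⟨ψ₀, hψ₀u, hψ₀gs, hB⟩ := exists_groundState_order_at_one U L n hn B t₁ ht₁ h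
  obtain ⟨a, ha⟩ := huniq ψ₀ ψ hψ₀gs hψgs
  rwa [re_expect_eq_of_smul _ hψ₀u hψu ha]

/-- **Uniform walk on `[t₁,1)` + uniqueness at the uniform point ⇒ the every-GS order bound of the
pure torus along `L ∈ 4ℕ`** (the census's decomposition D4 without its `stub_evenSides` piece:
`UniformWalkIco ∧ UniqueAtOne → EveryGSOrderFour`, all three written out; `-1 ≤ δ`). With the
mod-4 residue `stub_evenSides` and the landed `summitMatrix_of_everyGSOrder` this would give the
summit's matrix at `(U,δ)`; both remaining hypotheses are open and `UniformWalkIco` is at least as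
strong as the crux at `(U,δ)`. Kato (1966) II §5.1. [folklore] -/
theorem everyGSOrderFour_of_walk_of_unique :
    ∀ (U δ : ℝ), -1 ≤ δ →
      (∃ t₁ ∈ Set.Ioo (0:ℝ) 1, ∃ c : ℝ, 0 < c ∧ ∃ L₀ : ℕ, ∀ (L : ℕ) [NeZero L], L₀ ≤ L → 4 ∣ L →
        ∀ t' ∈ Set.Ico t₁ 1, ∀ ψ : Fock (Orb (FermionTorus 2 L)), star ψ ⬝ᵥ ψ = 1 →
          IsGroundStateInSector
            (hamiltonian ((fermionTorusGraph 2 L) \ SimpleGraph.comap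
                (fun x : FermionTorus 2 L => fun i : Fin 2 => ((ofLex x) i : ℕ) / 2) ⊤) 1 U +
              hamiltonian ((fermionTorusGraph 2 L) ⊓ SimpleGraph.comap
                (fun x : FermionTorus 2 L => fun i : Fin 2 => ((ofLex x) i : ℕ) / 2) ⊤) t' 0)
            (2 * ⌊(1 - δ) * (L : ℝ) ^ 2 / 2⌋₊) 0 ψ →
            c * (L : ℝ) ^ 4 ≤ (expect ((pairField dWaveFormFactor L)ᴴ * pairField dWaveFormFactor L) ψ).re) →
      (∃ L₀ : ℕ, ∀ (L : ℕ) [NeZero L], L₀ ≤ L → 4 ∣ L →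
        ∀ ψ φ : Fock (Orb (FermionTorus 2 L)),
          IsGroundStateInSector (hubbardTorus 2 L 1 U) (2 * ⌊(1 - δ) * (L : ℝ) ^ 2 / 2⌋₊) 0 ψ →
          IsGroundStateInSector (hubbardTorus 2 L 1 U) (2 * ⌊(1 - δ) * (L : ℝ) ^ 2 / 2⌋₊) 0 φ →
            ∃ a : ℂ, φ = a • ψ) →
      ∃ c : ℝ, 0 < c ∧ ∃ L₀ : ℕ, ∀ (L : ℕ) [NeZero L], L₀ ≤ L → 4 ∣ L →
        ∀ ψ : Fock (Orb (FermionTorus 2 L)), star ψ ⬝ᵥ ψ = 1 →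
          IsGroundStateInSector (hubbardTorus 2 L 1 U) (2 * ⌊(1 - δ) * (L : ℝ) ^ 2 / 2⌋₊) 0 ψ →
            c * (L : ℝ) ^ 4 ≤ (expect ((pairField dWaveFormFactor L)ᴴ * pairField dWaveFormFactor L) ψ).re := by
  intro U δ hδ h huniq
  obtain ⟨t₁, ht₁, c, hc, L₀, hL⟩ := h
  obtain ⟨L₁, hU⟩ := huniq
  refine ⟨c, hc, max L₀ L₁, fun L _ hLm h4 ψ hψ hgs => ?_⟩
  exact forall_groundState_order_at_one_of_unique U L _
    (Summit.HubbardSuperconductivity.NoGo.floor_pairNumber_le δ hδ L) _ t₁ ht₁.2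
    (fun t' ht' φ hφ hφgs => hL L (le_of_max_le_left hLm) h4 t' ht' φ hφ hφgs)
    (hU L (le_of_max_le_right hLm) h4) ψ hψ hgs

end Summit.HubbardSuperconductivity.PbContinuation

end
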